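import Summits.ResolutionOfSingularities.ResolutionOfSingularities.Theorems.FrobeniusClosingSteerEtaleResidueLift
import Mathlib.FieldTheory.SeparableDegree
import Mathlib.FieldTheory.PrimitiveElement
import HarnessLib

/-!
# [OURS · L0 W4.1] K3ᴳ (F4b): the RESIDUE FIELD of the étale residue enlargement `T := (S[X]/(P))_𝔫` is FINITE SEPARABLE over `κ(S)`, generated by
# the residue of the root
# (chain W4.1 `FrobeniusClosingSteer`, crux stmt-ResolutionOfSingularities-16345; K3ᴳ = `K3GTarget.horizonBaseChange`, res-L0-w41-stub-2 signature
# 8151858124874f54; `--supports … --as helper`)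

HONEST FRAMING. OURS kernel (HIRONAKA-L librarian res-D-lib-1 gen 8), an addendum to `…EtaleResidueLift` (K3-a): with `𝔫 := ker (S[X]/(P) → k′, X ↦ θ)`
and `T := (S[X]/(P))_𝔫`, the residue field `κ(T)` is `κ(S)(x̄)` for the residue `x̄` of the root (`residue_algebraMap_surjective`), `x̄` is a root of the
reduction `P̄` of `P`, hence — `P` monic with separable reduction — `κ(T)/κ(S)` is FINITE (`finite_residueField_localization_ker_lift`) and SEPARABLE
(`isSeparable_residueField_localization_ker_lift`). K3ᴳ uses this to transport finite 2-bases and dual 2-frames to the lifted chain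
(`TwoBasis.isTwoBasis_algebraMap_of_isSeparable`, `TwoBasis.exists_pFrame_of_isSeparable`).
Nothing here is a statement of H. Hironaka's manuscript [Hironaka2017]. AI-written; AI review is weaker than expert review. [folklore]
-/

set_option linter.dupNamespace false

noncomputable section

universe u

namespace Summit.ResolutionOfSingularities.ResolutionOfSingularities.Theorems.SwitchingDichotomy.EtaleLift

open IsLocalRing Polynomial

variable {S : Type u} [CommRing S] [IsLocalRing S] (P : S[X]) {k' : Type u} [Field k'] (φ : ResidueField S →+* k') (θ : k')
  (hθ : P.eval₂ (φ.comp (residue S)) θ = 0)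

/-- The composite `S → S[X]/(P) → T → κ(T)` is `κ(S) → κ(T)` after `residue S` (Mathlib's residue-field algebra of the LOCAL map `S → T`). [folklore] -/
theorem algebraMap_residueField_comp_residue (hP : P.Monic) :
    haveI := isMaximal_ker_lift P φ θ hθ hP
    haveI := isLocalHom_algebraMap_localization_ker_lift P φ θ hθ hP
    (algebraMap (ResidueField S) (ResidueField (Localization.AtPrime (RingHom.ker (AdjoinRoot.lift (φ.comp (residue S)) θ hθ))))).comp
        (residue S) =
      (residue _).comp ((algebraMap (AdjoinRoot P) (Localization.AtPrime (RingHom.ker (AdjoinRoot.lift (φ.comp (residue S)) θ hθ)))).comp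
        (algebraMap S (AdjoinRoot P))) := by
  haveI := isMaximal_ker_lift P φ θ hθ hP
  haveI := isLocalHom_algebraMap_localization_ker_lift P φ θ hθ hP
  set T := Localization.AtPrime (RingHom.ker (AdjoinRoot.lift (φ.comp (residue S)) θ hθ))
  ext s
  change algebraMap (ResidueField S) (ResidueField T) (residue S s) = residue T (algebraMap (AdjoinRoot P) T (algebraMap S _ s))
  rw [IsLocalRing.ResidueField.algebraMap_residue, ← IsScalarTower.algebraMap_apply]

/-- **The residue `x̄` of the root is a root of the reduction `P̄`** (read in `κ(T)` over `κ(S)`). [folklore] -/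
theorem aeval_residue_root (hP : P.Monic) :
    haveI := isMaximal_ker_lift P φ θ hθ hP
    haveI := isLocalHom_algebraMap_localization_ker_lift P φ θ hθ hP
    Polynomial.aeval (residue _ (algebraMap (AdjoinRoot P)
      (Localization.AtPrime (RingHom.ker (AdjoinRoot.lift (φ.comp (residue S)) θ hθ))) (AdjoinRoot.root P))) (P.map (residue S)) = 0 := by
  haveI := isMaximal_ker_lift P φ θ hθ hP
  haveI := isLocalHom_algebraMap_localization_ker_lift P φ θ hθ hP
  rw [Polynomial.aeval_def, Polynomial.eval₂_map, algebraMap_residueField_comp_residue P φ θ hθ hP, ← Polynomial.hom_eval₂,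
    ← Polynomial.hom_eval₂, ← Polynomial.aeval_def, AdjoinRoot.aeval_eq, AdjoinRoot.mk_self, map_zero, map_zero]

/-- **`κ(T) = κ(S)[x̄]`**: the residue of the root generates `κ(T)` as a `κ(S)`-algebra. [folklore] -/
theorem adjoin_residue_root_eq_top (hP : P.Monic) :
    haveI := isMaximal_ker_lift P φ θ hθ hP
    haveI := isLocalHom_algebraMap_localization_ker_lift P φ θ hθ hP
    Algebra.adjoin (ResidueField S) {residue _ (algebraMap (AdjoinRoot P)
      (Localization.AtPrime (RingHom.ker (AdjoinRoot.lift (φ.comp (residue S)) θ hθ))) (AdjoinRoot.root P))} = ⊤ := by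
  haveI := isMaximal_ker_lift P φ θ hθ hP
  haveI := isLocalHom_algebraMap_localization_ker_lift P φ θ hθ hP
  set T := Localization.AtPrime (RingHom.ker (AdjoinRoot.lift (φ.comp (residue S)) θ hθ))
  refine top_le_iff.mp fun z _ => ?_
  obtain ⟨a, rfl⟩ := residue_algebraMap_surjective P φ θ hθ hP z
  obtain ⟨q, rfl⟩ := AdjoinRoot.mk_surjective a
  -- `residue (alg [q]) = aeval x̄ q̄`
  have hq : residue T (algebraMap (AdjoinRoot P) T (AdjoinRoot.mk P q)) =
      Polynomial.aeval (residue T (algebraMap (AdjoinRoot P) T (AdjoinRoot.root P))) (q.map (residue S)) := by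
    rw [Polynomial.aeval_def, Polynomial.eval₂_map, algebraMap_residueField_comp_residue P φ θ hθ hP, ← Polynomial.hom_eval₂,
      ← Polynomial.hom_eval₂, ← Polynomial.aeval_def, AdjoinRoot.aeval_eq]
  change residue T (algebraMap (AdjoinRoot P) T (AdjoinRoot.mk P q)) ∈ _
  rw [hq]
  exact Polynomial.aeval_mem_adjoin_singleton _ _

/-- The residue of the root is integral over `κ(S)`. [folklore] -/
theorem isIntegral_residue_root (hP : P.Monic) :
    haveI := isMaximal_ker_lift P φ θ hθ hP
    haveI := isLocalHom_algebraMap_localization_ker_lift P φ θ hθ hP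
    IsIntegral (ResidueField S) (residue _ (algebraMap (AdjoinRoot P)
      (Localization.AtPrime (RingHom.ker (AdjoinRoot.lift (φ.comp (residue S)) θ hθ))) (AdjoinRoot.root P))) := by
  haveI := isMaximal_ker_lift P φ θ hθ hP
  haveI := isLocalHom_algebraMap_localization_ker_lift P φ θ hθ hP
  exact ⟨P.map (residue S), hP.map _, by rw [← Polynomial.aeval_def]; exact aeval_residue_root P φ θ hθ hP⟩

/-- **`κ(T)/κ(S)` is finite.** [folklore] -/
theorem finite_residueField_localization_ker_lift (hP : P.Monic) :
    haveI := isMaximal_ker_lift P φ θ hθ hP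
    haveI := isLocalHom_algebraMap_localization_ker_lift P φ θ hθ hP
    Module.Finite (ResidueField S)
      (ResidueField (Localization.AtPrime (RingHom.ker (AdjoinRoot.lift (φ.comp (residue S)) θ hθ)))) := by
  haveI := isMaximal_ker_lift P φ θ hθ hP
  haveI := isLocalHom_algebraMap_localization_ker_lift P φ θ hθ hP
  have hfg := (isIntegral_residue_root P φ θ hθ hP).fg_adjoin_singleton
  rw [adjoin_residue_root_eq_top P φ θ hθ hP, Algebra.top_toSubmodule] at hfg
  exact Module.finite_def.mpr hfg

/-- **`κ(T)/κ(S)` is separable** (`P` monic with separable reduction). [folklore] -/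
theorem isSeparable_residueField_localization_ker_lift (hP : P.Monic) (hsep : (P.map (residue S)).Separable) :
    haveI := isMaximal_ker_lift P φ θ hθ hP
    haveI := isLocalHom_algebraMap_localization_ker_lift P φ θ hθ hP
    Algebra.IsSeparable (ResidueField S)
      (ResidueField (Localization.AtPrime (RingHom.ker (AdjoinRoot.lift (φ.comp (residue S)) θ hθ)))) := by
  haveI := isMaximal_ker_lift P φ θ hθ hP
  haveI := isLocalHom_algebraMap_localization_ker_lift P φ θ hθ hP
  set T := Localization.AtPrime (RingHom.ker (AdjoinRoot.lift (φ.comp (residue S)) θ hθ))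
  set x := residue T (algebraMap (AdjoinRoot P) T (AdjoinRoot.root P)) with hx
  have hint : IsIntegral (ResidueField S) x := isIntegral_residue_root P φ θ hθ hP
  -- `x` is separable: its minimal polynomial divides the separable `P̄`
  have hxsep : IsSeparable (ResidueField S) x := hsep.of_dvd (minpoly.dvd _ _ (aeval_residue_root P φ θ hθ hP))
  -- `κ(S)⟮x⟯ = ⊤`
  have htop : IntermediateField.adjoin (ResidueField S) {x} = ⊤ := by
    apply IntermediateField.toSubalgebra_injective
    rw [IntermediateField.adjoin_simple_toSubalgebra_of_isAlgebraic hint.isAlgebraic, IntermediateField.top_toSubalgebra, hx]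
    exact adjoin_residue_root_eq_top P φ θ hθ hP
  haveI := (IntermediateField.isSeparable_adjoin_simple_iff_isSeparable (ResidueField S) (ResidueField T)).2 hxsep
  exact AlgEquiv.Algebra.isSeparable ((IntermediateField.equivOfEq htop).trans IntermediateField.topEquiv)

end Summit.ResolutionOfSingularities.ResolutionOfSingularities.Theorems.SwitchingDichotomy.EtaleLift

end
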